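import Summits.BirchSwinnertonDyer.Rank1Residual.X12.CMInertTrace
import Summits.BirchSwinnertonDyer.Rank1Residual.X12.CMIsogenyInvariance
import Summits.BirchSwinnertonDyer.Rank1Residual.X12.CMNoPrimeTorsion
import Summits.BirchSwinnertonDyer.Rank1Residual.X12.RamifiedLocalTypes
import Literature.NumberTheory.EllipticCurves.ComplexMultiplicationDeuringFrobeniusProofs
import Literature.NumberTheory.EllipticCurves.CMGroupOrderCyclotomicTorsion
import Literature.NumberTheory.EllipticCurves.SupersingularDensitySerreFrobeniusProofs
import Literature.NumberTheory.EllipticCurves.PAdicGrossZagierConstantTermProofs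
import Literature.NumberTheory.EllipticCurves.ModularityVersionApProofs
import Literature.NumberTheory.EllipticCurves.LFunctionPrimeCoeff
import Mathlib.NumberTheory.LegendreSymbol.QuadraticReciprocity
import HarnessLib

/-!
# Crux `PrintCFram.BottomClassIndexLawFiveLe` (stmt-BirchSwinnertonDyer-20372): NO BERTOLINI–DARMON ADMISSIBLE PRIMES EXIST
# ON THE CM-RAMIFIED CLASS — the level-raising primes of a member are exactly the primes `q ≡ ±1 (mod p)`

Cell `bsd-print-cfram`, LEAD seat `bsd-line-cfram-p1` (generation g15); helper `--supports stmt-BirchSwinnertonDyer-20372`.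
THEOREMS ONLY: no definition, no named fact, no `sorry`. BSD is not proved by any of this; no summit statement is proved by
this seat; the crux is NOT claimed false.

WHAT THIS FILE PROVES (unconditionally, from Deuring's theorem as PROVED in the tree). Let `W/ℚ` be a globally minimal CM curve
with `p ≥ 5` CM-RAMIFIED (`K = ℚ(√−p)`, `p ∈ {7, 11, 19, 43, 67, 163}`; no hypothesis on the analytic rank). For every prime
`q ∤ p·N_W`:

* `frobeniusTrace_eq_zero_or_dvd_sq_sub` — **either `a_q(W) = 0` or `p ∣ a_q(W)² − 4q`** (`q` odd). Proof: pass to an isogenous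
  globally minimal model `W'` with `j(W') ∈ maximalCMJInvariants` (`X12.exists_isGloballyMinimal_isIsogenous_maximal_cmFieldDiscr_eq`,
  same `a_q` by Faltings `frobeniusTrace_eq_of_isIsogenous`); if `(−p/q) = −1` then `a_q = 0` (Deuring, inert case:
  `X12.frobeniusTrace_eq_zero_of_legendreSym_cmFieldDiscr_eq_neg_one`); if `(−p/q) = +1` then `a_q = π + π̄` with `π ∈ ℤ[(1+√−p)/2]`,
  `ππ̄ = q` (`Deuring1941_frobeniusTrace_eq_add_conj_holds`), i.e. `a_q = t` with `t² + p b² = 4q`, so `a_q² ≡ 4q (mod p)`.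
* `not_admissible` — **no prime `q ∤ p·N_W` satisfies `p ∤ q² − 1` together with `a_q(W) ≡ ±(q + 1) (mod p)`**: in the first case
  `p ∣ q + 1`; in the second `(q+1)² ≡ a_q² ≡ 4q` gives `p ∣ (q−1)²`, `p ∣ q − 1`; `q = 2` is excluded by Hasse (`|a_2| ≤ 2`, `p ≥ 7`).
  This is exactly the conjunction «`¬ p ∣ q² − 1 ∧ (p ∣ a_q − (q+1) ∨ p ∣ a_q + (q+1))`» that defines a `1`-ADMISSIBLE prime in the
  sense of Bertolini–Darmon 2005 (§2.2) / C.-H. Kim 2024 (§2.4), as typed in the published line `Lines/bipartite_toric_borel.lean` of this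
  crux (stubs S2 `stub_bipartiteLower_borelCM`, S3 `stub_companionPeriodUnit_borelCM`).
* `no_admissible_level` — hence no square-free `n` with an ODD number of prime factors all admissible exists (any extra clause `R q`
  on the primes allowed): the «definite unit datum» of that line has an EMPTY index set for every member of the class.
* §4 (appended): the two cases separately (`frobeniusTrace_eq_zero_of_legendreSym_eq_neg_one`, `exists_sq_add_mul_sq_of_legendreSym_eq_one`)
  and the exact LEVEL-RAISING SET of the class: `levelRaising_iff_dvd_sq_sub_one` — for `q ∤ p·N_W`, `a_q(W) ≡ ±(q+1) (mod p)` ⟺ `p ∣ q² − 1`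
  (quadratic reciprocity `(−p/q) = (q/p)`): the level-raising primes are EXACTLY the primes `q ≡ ±1 (mod p)`, i.e. exactly the non-admissible ones.

CONSEQUENCE FOR THE PLANNING OF THE B1 RESIDUE (the LEAD's reading; the kernel statements are the three theorems above): road II-bis
(bipartite Euler systems / level raising at admissible primes: Bertolini–Darmon 2005, W. Zhang 2014, Kim 2024) is VACUOUS on this class
— the Eisenstein residual representation `𝔽_p(φ) ⊕ 𝔽_p(φ⁻¹ω)`, `φ² = ω·(·/p)`, makes the level-raising congruence `a_q ≡ ±(q+1)`
equivalent to `q ≡ ±1 (mod p)` (split: `q ≡ 1`; inert: `q ≡ −1`), which admissibility forbids. Kolyvagin primes in Kolyvagin's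
original sense (`q ≡ −1 (mod p)`, `q` inert in `K`, `a_q = 0`) are NOT affected. See the LEAD g15 crux notes for the dossier.

References: Deuring 1941; Cox, *Primes of the form x² + ny²*, Thm. 14.16; Silverman AEC V.1.1 (Hasse); Bertolini–Darmon, Ann. of
Math. 162 (2005) §2.2 (admissible primes); C.-H. Kim, Trans. AMS 377 (2024) §2.4; W. Zhang, Camb. J. Math. 2 (2014) §3.
-/

set_option autoImplicit false
-- `…BirchSwinnertonDyer.BirchSwinnertonDyer.Theorems…` is the problem's mandated namespace (D-0017).
set_option linter.dupNamespace false

noncomputable section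

open scoped Classical ComplexConjugate

namespace Summit.BirchSwinnertonDyer.BirchSwinnertonDyer.Theorems.PrintCFram.NoAdmissiblePrimes

open WeierstrassCurve Literature.NumberTheory.EllipticCurves Literature.NumberTheory.EllipticCurves.Rank1Residual
open Summit.BirchSwinnertonDyer.Rank1Residual

/-! ## §1 Elementary arithmetic -/

/-- If `p ∣ a² − 4q` and `a ≡ ±(q+1) (mod p)` (`p` prime) then `p ∣ q² − 1`: `(q+1)² − 4q = (q−1)²`. [folklore] -/
theorem dvd_sq_sub_one_of_dvd_sq_sub {p q : ℕ} (hp : p.Prime) {a : ℤ} (hsq : (p : ℤ) ∣ a ^ 2 - 4 * q)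
    (hadm : (p : ℤ) ∣ a - (q + 1) ∨ (p : ℤ) ∣ a + (q + 1)) : (p : ℤ) ∣ (q : ℤ) ^ 2 - 1 := by
  have hp' : Prime (p : ℤ) := Nat.prime_iff_prime_int.mp hp
  have h1 : (p : ℤ) ∣ a ^ 2 - ((q : ℤ) + 1) ^ 2 := by
    rcases hadm with h | h
    · have : a ^ 2 - ((q : ℤ) + 1) ^ 2 = (a - (q + 1)) * (a + (q + 1)) := by ring
      rw [this]; exact Dvd.dvd.mul_right h _
    · have : a ^ 2 - ((q : ℤ) + 1) ^ 2 = (a + (q + 1)) * (a - (q + 1)) := by ring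
      rw [this]; exact Dvd.dvd.mul_right h _
  have h2 : (p : ℤ) ∣ ((q : ℤ) - 1) ^ 2 := by
    have : ((q : ℤ) - 1) ^ 2 = (a ^ 2 - 4 * q) - (a ^ 2 - ((q : ℤ) + 1) ^ 2) := by ring
    rw [this]; exact dvd_sub hsq h1
  have h3 : (p : ℤ) ∣ (q : ℤ) - 1 := hp'.dvd_of_dvd_pow h2
  have : (q : ℤ) ^ 2 - 1 = ((q : ℤ) - 1) * ((q : ℤ) + 1) := by ring
  rw [this]; exact Dvd.dvd.mul_right h3 _

/-- If `a = 0` and `a ≡ ±(q+1) (mod p)` then `p ∣ q² − 1`. [folklore] -/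
theorem dvd_sq_sub_one_of_eq_zero {p q : ℕ} {a : ℤ} (ha : a = 0)
    (hadm : (p : ℤ) ∣ a - (q + 1) ∨ (p : ℤ) ∣ a + (q + 1)) : (p : ℤ) ∣ (q : ℤ) ^ 2 - 1 := by
  subst ha
  have h1 : (p : ℤ) ∣ (q : ℤ) + 1 := by
    rcases hadm with h | h
    · have : (q : ℤ) + 1 = -(0 - ((q : ℤ) + 1)) := by ring
      rw [this]; exact (dvd_neg).mpr h
    · simpa using h
  have : (q : ℤ) ^ 2 - 1 = ((q : ℤ) + 1) * ((q : ℤ) - 1) := by ring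
  rw [this]; exact Dvd.dvd.mul_right h1 _

/-- Hasse at `q = 2` against `p ≥ 7`: if `a² ≤ 8` then `p ∤ a ∓ 3`. [folklore] -/
theorem not_dvd_of_sq_le_eight {p : ℕ} (hp7 : 7 ≤ p) {a : ℤ} (ha : a ^ 2 ≤ 4 * 2) :
    ¬ ((p : ℤ) ∣ a - (2 + 1) ∨ (p : ℤ) ∣ a + (2 + 1)) := by
  have hle : a ≤ 2 := by nlinarith
  have hge : -2 ≤ a := by nlinarith
  have hp7' : (7 : ℤ) ≤ p := by exact_mod_cast hp7
  rintro (h | h)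
  · -- `a - 3 ∈ [-5, -1]`
    have hpos : 0 < -(a - (2 + 1)) := by omega
    have hle' := Int.le_of_dvd hpos ((dvd_neg).mpr h)
    omega
  · have hpos : 0 < a + (2 + 1) := by omega
    have hle' := Int.le_of_dvd hpos h
    omega

/-! ## §2 Deuring on the CM-ramified class: `a_q = 0` or `a_q² ≡ 4q (mod p)` -/

/-- **The trace dichotomy on the CM-ramified class.** For `W/ℚ` globally minimal with CM, `p ≥ 5` CM-ramified, and an odd prime
`q ≠ p` of good reduction: `a_q(W) = 0` (if `q` is inert in `ℚ(√−p)`) or `p ∣ a_q(W)² − 4q` (if `q` splits: `a_q = π + π̄`,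
`ππ̄ = q`, `π ∈ ℤ[(1+√−p)/2]`, so `a_q² + p b² = 4q`). [cite: Cox2013, Thm. 14.16] [cite: Lang1987, Ch. 13 §4 Thm. 12 (PDF p. 140)] -/
theorem frobeniusTrace_eq_zero_or_dvd_sq_sub (W : WeierstrassCurve ℚ) [W.IsElliptic] [W.IsGloballyMinimal]
    (p : ℕ) [Fact p.Prime] (hCM : W.HasCM) (hram : CMRamified W p) (h5 : 5 ≤ p)
    (q : ℕ) [hq : Fact q.Prime] (hq2 : q ≠ 2) (hqp : q ≠ p) (hgood : W.HasGoodReductionAtPrime q) :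
    W.frobeniusTrace q = 0 ∨ (p : ℤ) ∣ W.frobeniusTrace q ^ 2 - 4 * q := by
  have hp : p.Prime := Fact.out
  have hj : W.j ∈ cmJInvariants := (hasCM_iff_j_mem_holds W).mp hCM
  have hdK : cmFieldDiscrOfJ W.j = -(p : ℤ) := X12.cmFieldDiscrOfJ_eq_neg_of_dvd W hCM hp h5 hram
  have hp4 : p % 4 = 3 := (X12.eq_natAbs_cmFieldDiscrOfJ_of_cmRamified W p hCM h5 hram).2.1
  obtain ⟨W', _, _, hiso, hj', hdisc'⟩ := X12.exists_isGloballyMinimal_isIsogenous_maximal_cmFieldDiscr_eq W hj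
  have hd' : cmFieldDiscr W'.j = -(p : ℤ) := hdisc'.trans hdK
  have hgood' : W'.HasGoodReductionAtPrime q := (hiso.hasGoodReductionAtPrime_iff q).mp hgood
  have htr : W.frobeniusTrace q = W'.frobeniusTrace q := frobeniusTrace_eq_of_isIsogenous hiso q hgood hgood'
  have hΔ' : ¬ (q : ℤ) ∣ minimalDiscriminantInt W' := W'.not_dvd_minimalDiscriminantInt_of_hasGoodReductionAtPrime q hgood'
  -- `-p` is a unit mod `q`
  have hpq0 : ((-(p : ℤ) : ℤ) : ZMod q) ≠ 0 := by
    rw [Ne, ZMod.intCast_zmod_eq_zero_iff_dvd, dvd_neg]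
    intro h
    exact hqp ((Nat.prime_dvd_prime_iff_eq hq.out hp).mp (by exact_mod_cast h))
  rcases legendreSym.eq_one_or_neg_one q hpq0 with hsplit | hinert
  · -- split: Deuring `a_q = π + π̄`, `ππ̄ = q`
    right
    have hsq : IsSquare ((cmDiscr W'.j : ℤ) : ZMod q) := by
      rw [X12.cmDiscr_eq_cmFieldDiscr, hd']
      exact (legendreSym.eq_one_iff q hpq0).mp hsplit
    have hdq : ¬ (q : ℤ) ∣ cmDiscr W'.j := by
      rw [X12.cmDiscr_eq_cmFieldDiscr, hd', dvd_neg]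
      intro h
      exact hqp ((Nat.prime_dvd_prime_iff_eq hq.out hp).mp (by exact_mod_cast h))
    obtain ⟨π, hπ, hππ, htr'⟩ := Deuring1941_frobeniusTrace_eq_add_conj_holds W' hj' q hq.out hq2 hΔ' hdq hsq
    rw [X12.cmDiscr_eq_cmFieldDiscr, hd'] at hπ
    -- `c = (p² + p)/4`
    obtain ⟨c, hc⟩ : ∃ c : ℤ, (-(p : ℤ)) * (-(p : ℤ) - 1) = 4 * c := by
      have h4 : (4 : ℤ) ∣ (p : ℤ) + 1 := by
        have : (p : ℤ) % 4 = 3 := by exact_mod_cast hp4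
        omega
      obtain ⟨m, hm⟩ := h4
      exact ⟨p * m, by linear_combination (p : ℤ) * hm⟩
    obtain ⟨a, b, rfl⟩ := (mem_cmRing_iff (d := -(p : ℤ)) (c := c) (by omega) hc).1 hπ
    have hsum : ((a : ℂ) + b * cmGen (-(p : ℤ))) + conj ((a : ℂ) + b * cmGen (-(p : ℤ))) = ((2 * a - p * b : ℤ) : ℂ) := by
      rw [map_add, map_mul, map_intCast, map_intCast, conj_cmGen]
      push_cast
      ring
    have hnorm := norm_cmRing (d := -(p : ℤ)) (c := c) (by omega) hc a b
    rw [hnorm] at hππ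
    rw [hsum] at htr'
    have hq' : (a * a + a * b * (-(p : ℤ)) + b * b * c : ℤ) = q := by exact_mod_cast hππ
    have ht : W'.frobeniusTrace q = 2 * a - p * b := by exact_mod_cast htr'
    have h4 := four_mul_norm_cmRing (d := -(p : ℤ)) (c := c) hc a b
    rw [hq'] at h4
    -- `4q = (2a - pb)² + p b²`
    rw [htr, ht]
    exact ⟨-(b ^ 2), by linear_combination (-1 : ℤ) * h4⟩
  · -- inert: `a_q = 0`
    left
    have hqd : ¬ (q : ℤ) ∣ 2 * cmFieldDiscr W'.j := by
      rw [hd']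
      intro h
      have hq' : Prime (q : ℤ) := Nat.prime_iff_prime_int.mp hq.out
      rcases hq'.dvd_or_dvd h with h2 | hp'
      · have : q ∣ 2 := by exact_mod_cast h2
        exact hq2 ((Nat.prime_dvd_prime_iff_eq hq.out Nat.prime_two).mp this)
      · rw [dvd_neg] at hp'
        exact hqp ((Nat.prime_dvd_prime_iff_eq hq.out hp).mp (by exact_mod_cast hp'))
    have hinert' : legendreSym q (cmFieldDiscr W'.j) = -1 := by rw [hd']; exact hinert
    rw [htr]
    exact X12.frobeniusTrace_eq_zero_of_legendreSym_cmFieldDiscr_eq_neg_one W' hj' q hqd hΔ' hinert'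

/-! ## §3 No admissible primes, no admissible level -/

/-- **No Bertolini–Darmon `1`-admissible prime exists for a member of the CM-ramified class.** For `W/ℚ` globally minimal with CM,
`p ≥ 5` CM-ramified, `N = N_W`, and ANY prime `q ∤ N·p`: it is NOT the case that `p ∤ q² − 1` and `a_q(W) ≡ ±(q+1) (mod p)`.
(The level-raising congruence forces `q ≡ 1 (mod p)` at a split `q` and `q ≡ −1 (mod p)` at an inert `q`; `q = 2` by Hasse.)
[cite: BertoliniDarmon2005, §2.2 (admissible primes)] [cite: Cox2013, Thm. 14.16] [cite: SilvermanAEC2009, Thm. V.1.1] -/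
theorem not_admissible (W : WeierstrassCurve ℚ) [W.IsElliptic] [W.IsGloballyMinimal] (p : ℕ) [Fact p.Prime]
    (hCM : W.HasCM) (hram : CMRamified W p) (h5 : 5 ≤ p) {N : ℕ} (hN : W.conductorNorm ℤ = N)
    (q : ℕ) (hq : q.Prime) (hqN : ¬ q ∣ N * p) :
    ¬ (¬ (p : ℤ) ∣ (q : ℤ) ^ 2 - 1 ∧ ((p : ℤ) ∣ W.LFunction q - (q + 1) ∨ (p : ℤ) ∣ W.LFunction q + (q + 1))) := by
  haveI := Fact.mk hq
  have hp : p.Prime := Fact.out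
  have hp4 : p % 4 = 3 := (X12.eq_natAbs_cmFieldDiscrOfJ_of_cmRamified W p hCM h5 hram).2.1
  have hp7 : 7 ≤ p := by
    rcases Nat.lt_or_ge p 7 with h | h
    · interval_cases p <;> simp_all (config := {decide := true})
    · exact h
  have hqN' : ¬ q ∣ W.conductorNorm ℤ := by rw [hN]; exact fun h ↦ hqN (Dvd.dvd.mul_right h p)
  have hqp : q ≠ p := by rintro rfl; exact hqN (Dvd.intro_left _ rfl)
  have hgood : W.HasGoodReductionAtPrime q := by
    by_contra h
    exact hqN' ((W.dvd_conductorNorm_iff_not_hasGoodReductionAtPrime q).mpr h)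
  rintro ⟨hnd, hadm⟩
  rw [LFunction_apply_prime_eq_frobeniusTrace W q hgood] at hadm
  by_cases hq2 : q = 2
  · subst hq2
    have hH := W.frobeniusTrace_sq_le_four_mul 2 hgood
    exact not_dvd_of_sq_le_eight hp7 (by exact_mod_cast hH) (by exact_mod_cast hadm)
  · apply hnd
    rcases frobeniusTrace_eq_zero_or_dvd_sq_sub W p hCM hram h5 q hq2 hqp hgood with h0 | hsq
    · exact dvd_sq_sub_one_of_eq_zero h0 hadm
    · exact dvd_sq_sub_one_of_dvd_sq_sub hp hsq hadm

/-- **No admissible LEVEL exists**: for a member of the CM-ramified class there is no `n` with an odd number of prime factors all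
of which are `1`-admissible (with any additional clause `R q` on the primes, e.g. «`q` inert in the auxiliary Heegner field»).
This is the index set of the «definite unit datum» of the published line `bipartite_toric_borel` (stubs S2/S3): it is EMPTY.
[cite: BertoliniDarmon2005, §2.2] [cite: Kim2024, §2.4 (arXiv:2203.12161)] -/
theorem no_admissible_level (W : WeierstrassCurve ℚ) [W.IsElliptic] [W.IsGloballyMinimal] (p : ℕ) [Fact p.Prime]
    (hCM : W.HasCM) (hram : CMRamified W p) (h5 : 5 ≤ p) {N : ℕ} (hN : W.conductorNorm ℤ = N)
    (R : ℕ → Prop) (n : ℕ) (hodd : Odd n.primeFactors.card)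
    (hadm : ∀ q ∈ n.primeFactors, ¬ q ∣ N * p ∧ R q ∧ ¬ (p : ℤ) ∣ (q : ℤ) ^ 2 - 1 ∧
      ((p : ℤ) ∣ W.LFunction q - (q + 1) ∨ (p : ℤ) ∣ W.LFunction q + (q + 1))) : False := by
  have hne : n.primeFactors.Nonempty := by
    rw [Finset.nonempty_iff_ne_empty]
    intro h
    rw [h, Finset.card_empty] at hodd
    exact (Nat.not_odd_iff_even.mpr (by decide)) hodd
  obtain ⟨q, hq⟩ := hne
  obtain ⟨hqN, -, hnd, hcong⟩ := hadm q hq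
  exact not_admissible W p hCM hram h5 hN q (Nat.prime_of_mem_primeFactors hq) hqN ⟨hnd, hcong⟩

end Summit.BirchSwinnertonDyer.BirchSwinnertonDyer.Theorems.PrintCFram.NoAdmissiblePrimes

namespace Summit.BirchSwinnertonDyer.BirchSwinnertonDyer.Theorems.PrintCFram.NoAdmissiblePrimes

open WeierstrassCurve Literature.NumberTheory.EllipticCurves Literature.NumberTheory.EllipticCurves.Rank1Residual
open Summit.BirchSwinnertonDyer.Rank1Residual

open scoped NumberTheorySymbols

/-! ## §4 (appended, LEAD g15) The two cases separately, and the LEVEL-RAISING SET of the class = `{q ≡ ±1 (mod p)}` exactly -/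

/-- **Inert case.** `W` CM, `p ≥ 5` CM-ramified, `q` odd good, `q ≠ p`, `(−p/q) = −1`: `a_q(W) = 0` (Deuring; tree
`X12.frobeniusTrace_eq_zero_of_legendreSym_cmFieldDiscr_eq_neg_one` transported along `W ∼ W'`, `j(W')` maximal).
[cite: Lang1987, Ch. 13 §4 Thm. 12 (PDF p. 140)] -/
theorem frobeniusTrace_eq_zero_of_legendreSym_eq_neg_one (W : WeierstrassCurve ℚ) [W.IsElliptic] [W.IsGloballyMinimal]
    (p : ℕ) [Fact p.Prime] (hCM : W.HasCM) (hram : CMRamified W p) (h5 : 5 ≤ p)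
    (q : ℕ) [hq : Fact q.Prime] (hq2 : q ≠ 2) (hqp : q ≠ p) (hgood : W.HasGoodReductionAtPrime q)
    (hinert : legendreSym q (-(p : ℤ)) = -1) : W.frobeniusTrace q = 0 := by
  have hp : p.Prime := Fact.out
  have hj : W.j ∈ cmJInvariants := (hasCM_iff_j_mem_holds W).mp hCM
  have hdK : cmFieldDiscrOfJ W.j = -(p : ℤ) := X12.cmFieldDiscrOfJ_eq_neg_of_dvd W hCM hp h5 hram
  obtain ⟨W', _, _, hiso, hj', hdisc'⟩ := X12.exists_isGloballyMinimal_isIsogenous_maximal_cmFieldDiscr_eq W hj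
  have hd' : cmFieldDiscr W'.j = -(p : ℤ) := hdisc'.trans hdK
  have hgood' : W'.HasGoodReductionAtPrime q := (hiso.hasGoodReductionAtPrime_iff q).mp hgood
  have hΔ' : ¬ (q : ℤ) ∣ minimalDiscriminantInt W' := W'.not_dvd_minimalDiscriminantInt_of_hasGoodReductionAtPrime q hgood'
  have hqd : ¬ (q : ℤ) ∣ 2 * cmFieldDiscr W'.j := by
    rw [hd']
    intro h
    have hq' : Prime (q : ℤ) := Nat.prime_iff_prime_int.mp hq.out
    rcases hq'.dvd_or_dvd h with h2 | hp'
    · have : q ∣ 2 := by exact_mod_cast h2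
      exact hq2 ((Nat.prime_dvd_prime_iff_eq hq.out Nat.prime_two).mp this)
    · rw [dvd_neg] at hp'
      exact hqp ((Nat.prime_dvd_prime_iff_eq hq.out hp).mp (by exact_mod_cast hp'))
  have hinert' : legendreSym q (cmFieldDiscr W'.j) = -1 := by rw [hd']; exact hinert
  rw [frobeniusTrace_eq_of_isIsogenous hiso q hgood hgood']
  exact X12.frobeniusTrace_eq_zero_of_legendreSym_cmFieldDiscr_eq_neg_one W' hj' q hqd hΔ' hinert'

/-- **Split case.** `W` CM, `p ≥ 5` CM-ramified, `q` odd good, `q ≠ p`, `(−p/q) = +1`: `a_q(W) = t` with `t² + p b² = 4q` for some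
integers `t, b` (Deuring, `a_q = π + π̄`, `ππ̄ = q`, `π ∈ ℤ[(1+√−p)/2]`); in particular `p ∣ a_q² − 4q` and `a_q ≠ 0`.
[cite: Cox2013, Thm. 14.16] -/
theorem exists_sq_add_mul_sq_of_legendreSym_eq_one (W : WeierstrassCurve ℚ) [W.IsElliptic] [W.IsGloballyMinimal]
    (p : ℕ) [Fact p.Prime] (hCM : W.HasCM) (hram : CMRamified W p) (h5 : 5 ≤ p)
    (q : ℕ) [hq : Fact q.Prime] (hq2 : q ≠ 2) (hqp : q ≠ p) (hgood : W.HasGoodReductionAtPrime q)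
    (hsplit : legendreSym q (-(p : ℤ)) = 1) :
    ∃ t b : ℤ, t ^ 2 + p * b ^ 2 = 4 * q ∧ W.frobeniusTrace q = t := by
  have hp : p.Prime := Fact.out
  have hj : W.j ∈ cmJInvariants := (hasCM_iff_j_mem_holds W).mp hCM
  have hdK : cmFieldDiscrOfJ W.j = -(p : ℤ) := X12.cmFieldDiscrOfJ_eq_neg_of_dvd W hCM hp h5 hram
  have hp4 : p % 4 = 3 := (X12.eq_natAbs_cmFieldDiscrOfJ_of_cmRamified W p hCM h5 hram).2.1
  obtain ⟨W', _, _, hiso, hj', hdisc'⟩ := X12.exists_isGloballyMinimal_isIsogenous_maximal_cmFieldDiscr_eq W hj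
  have hd' : cmFieldDiscr W'.j = -(p : ℤ) := hdisc'.trans hdK
  have hgood' : W'.HasGoodReductionAtPrime q := (hiso.hasGoodReductionAtPrime_iff q).mp hgood
  have htr : W.frobeniusTrace q = W'.frobeniusTrace q := frobeniusTrace_eq_of_isIsogenous hiso q hgood hgood'
  have hΔ' : ¬ (q : ℤ) ∣ minimalDiscriminantInt W' := W'.not_dvd_minimalDiscriminantInt_of_hasGoodReductionAtPrime q hgood'
  have hpq0 : ((-(p : ℤ) : ℤ) : ZMod q) ≠ 0 := by
    rw [Ne, ZMod.intCast_zmod_eq_zero_iff_dvd, dvd_neg]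
    intro h
    exact hqp ((Nat.prime_dvd_prime_iff_eq hq.out hp).mp (by exact_mod_cast h))
  have hsq : IsSquare ((cmDiscr W'.j : ℤ) : ZMod q) := by
    rw [X12.cmDiscr_eq_cmFieldDiscr, hd']
    exact (legendreSym.eq_one_iff q hpq0).mp hsplit
  have hdq : ¬ (q : ℤ) ∣ cmDiscr W'.j := by
    rw [X12.cmDiscr_eq_cmFieldDiscr, hd', dvd_neg]
    intro h
    exact hqp ((Nat.prime_dvd_prime_iff_eq hq.out hp).mp (by exact_mod_cast h))
  obtain ⟨π, hπ, hππ, htr'⟩ := Deuring1941_frobeniusTrace_eq_add_conj_holds W' hj' q hq.out hq2 hΔ' hdq hsq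
  rw [X12.cmDiscr_eq_cmFieldDiscr, hd'] at hπ
  obtain ⟨c, hc⟩ : ∃ c : ℤ, (-(p : ℤ)) * (-(p : ℤ) - 1) = 4 * c := by
    have h4 : (4 : ℤ) ∣ (p : ℤ) + 1 := by
      have : (p : ℤ) % 4 = 3 := by exact_mod_cast hp4
      omega
    obtain ⟨m, hm⟩ := h4
    exact ⟨p * m, by linear_combination (p : ℤ) * hm⟩
  obtain ⟨a, b, rfl⟩ := (mem_cmRing_iff (d := -(p : ℤ)) (c := c) (by omega) hc).1 hπ
  have hsum : ((a : ℂ) + b * cmGen (-(p : ℤ))) + conj ((a : ℂ) + b * cmGen (-(p : ℤ))) = ((2 * a - p * b : ℤ) : ℂ) := by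
    rw [map_add, map_mul, map_intCast, map_intCast, conj_cmGen]
    push_cast
    ring
  have hnorm := norm_cmRing (d := -(p : ℤ)) (c := c) (by omega) hc a b
  rw [hnorm] at hππ
  rw [hsum] at htr'
  have hq' : (a * a + a * b * (-(p : ℤ)) + b * b * c : ℤ) = q := by exact_mod_cast hππ
  have ht : W'.frobeniusTrace q = 2 * a - p * b := by exact_mod_cast htr'
  have h4 := four_mul_norm_cmRing (d := -(p : ℤ)) (c := c) hc a b
  rw [hq'] at h4
  exact ⟨2 * a - p * b, b, by linear_combination (-1 : ℤ) * h4, by rw [htr, ht]⟩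

/-- **The level-raising set of the class is exactly the set of primes `q ≡ ±1 (mod p)`.** For `W` CM, `p ≥ 5` CM-ramified and a prime
`q ∤ p·N_W`: `a_q(W) ≡ ±(q+1) (mod p)` ⟺ `p ∣ q² − 1`. (⟹ is `not_admissible`; ⟸: `q ≡ −1` is inert with `a_q = 0 ≡ q + 1`, `q ≡ +1` is
split with `a_q² ≡ 4q ≡ 4`, `a_q ≡ ±2 ≡ ±(q+1)`; quadratic reciprocity `(−p/q) = (q/p)` for `p ≡ 3 (mod 4)`.) These are LEAD g13/g14's
«exceptional» primes of the analytic side, now in trace currency; Bertolini–Darmon admissibility excludes exactly them.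
[cite: Cox2013, Thm. 14.16] [cite: BertoliniDarmon2005, §2.2] [cite: DiamondTaylor1994, Thm. A (level raising)] -/
theorem levelRaising_iff_dvd_sq_sub_one (W : WeierstrassCurve ℚ) [W.IsElliptic] [W.IsGloballyMinimal] (p : ℕ) [Fact p.Prime]
    (hCM : W.HasCM) (hram : CMRamified W p) (h5 : 5 ≤ p) {N : ℕ} (hN : W.conductorNorm ℤ = N)
    (q : ℕ) (hq : q.Prime) (hqN : ¬ q ∣ N * p) :
    ((p : ℤ) ∣ W.LFunction q - (q + 1) ∨ (p : ℤ) ∣ W.LFunction q + (q + 1)) ↔ (p : ℤ) ∣ (q : ℤ) ^ 2 - 1 := by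
  haveI := Fact.mk hq
  have hp : p.Prime := Fact.out
  have hp4 : p % 4 = 3 := (X12.eq_natAbs_cmFieldDiscrOfJ_of_cmRamified W p hCM h5 hram).2.1
  have hp7 : 7 ≤ p := by
    rcases Nat.lt_or_ge p 7 with h | h
    · interval_cases p <;> simp_all (config := {decide := true})
    · exact h
  have hp2 : p ≠ 2 := by omega
  have hqN' : ¬ q ∣ W.conductorNorm ℤ := by rw [hN]; exact fun h ↦ hqN (Dvd.dvd.mul_right h p)
  have hqp : q ≠ p := by rintro rfl; exact hqN (Dvd.intro_left _ rfl)
  have hgood : W.HasGoodReductionAtPrime q := by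
    by_contra h
    exact hqN' ((W.dvd_conductorNorm_iff_not_hasGoodReductionAtPrime q).mpr h)
  constructor
  · intro hadm
    by_contra hnd
    exact not_admissible W p hCM hram h5 hN q hq hqN ⟨hnd, hadm⟩
  · intro hdvd
    have hp' : Prime (p : ℤ) := Nat.prime_iff_prime_int.mp hp
    -- `q ≠ 2`: `p ∣ 3` is impossible
    have hq2 : q ≠ 2 := by
      rintro rfl
      have h3 : (p : ℤ) ∣ 3 := by norm_num at hdvd; exact hdvd
      have := Int.le_of_dvd (by norm_num) h3
      omega
    rw [LFunction_apply_prime_eq_frobeniusTrace W q hgood]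
    -- quadratic reciprocity: `(−p/q) = (q/p)`
    have hrec : (legendreSym q (-(p : ℤ)) : ℤ) = J((q : ℤ) | p) := by
      rw [jacobiSym.legendreSym.to_jacobiSym]
      exact CyclotomicTorsionSign.jacobiSym_neg_eq_of_mod_four hp hp4 hq hq2 hqp
    have hfac : (p : ℤ) ∣ ((q : ℤ) + 1) * ((q : ℤ) - 1) := by
      have : ((q : ℤ) + 1) * ((q : ℤ) - 1) = (q : ℤ) ^ 2 - 1 := by ring
      rw [this]; exact hdvd
    rcases hp'.dvd_or_dvd hfac with hplus | hminus
    · -- `q ≡ −1 (mod p)`: inert, `a_q = 0`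
      have hJ : J((q : ℤ) | p) = -1 := by
        have hmod : (q : ℤ) % p = (-1 : ℤ) % p :=
          (Int.ModEq.symm ((Int.modEq_iff_dvd).mpr (by simpa [sub_neg_eq_add] using hplus)))
        rw [jacobiSym.mod_left' hmod, jacobiSym.at_neg_one (hp.odd_of_ne_two hp2), ZMod.χ₄_nat_three_mod_four hp4]
      have h0 := frobeniusTrace_eq_zero_of_legendreSym_eq_neg_one W p hCM hram h5 q hq2 hqp hgood (by rw [hrec, hJ])
      left
      rw [h0, zero_sub, dvd_neg]
      exact hplus
    · -- `q ≡ 1 (mod p)`: split, `a_q² ≡ 4`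
      have hJ : J((q : ℤ) | p) = 1 := by
        have hmod : (q : ℤ) % p = (1 : ℤ) % p :=
          (Int.ModEq.symm ((Int.modEq_iff_dvd).mpr (by simpa using hminus)))
        rw [jacobiSym.mod_left' hmod, jacobiSym.one_left]
      obtain ⟨t, b, htb, hat⟩ := exists_sq_add_mul_sq_of_legendreSym_eq_one W p hCM hram h5 q hq2 hqp hgood (by rw [hrec, hJ])
      rw [hat]
      -- `t² ≡ 4q ≡ 4 (mod p)`, so `p ∣ (t − 2)(t + 2)`; and `q + 1 ≡ 2`
      have h1 : (p : ℤ) ∣ (t - 2) * (t + 2) := by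
        have : (t - 2) * (t + 2) = (t ^ 2 + p * b ^ 2 - 4 * q) + 4 * ((q : ℤ) - 1) - p * b ^ 2 := by ring
        rw [this, htb, sub_self, zero_add]
        exact dvd_sub (Dvd.dvd.mul_left hminus 4) (Dvd.intro _ rfl)
      rcases hp'.dvd_or_dvd h1 with h2 | h2
      · left
        have : t - ((q : ℤ) + 1) = (t - 2) - ((q : ℤ) - 1) := by ring
        rw [this]; exact dvd_sub h2 hminus
      · right
        have : t + ((q : ℤ) + 1) = (t + 2) + ((q : ℤ) - 1) := by ring
        rw [this]; exact dvd_add h2 hminus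

end Summit.BirchSwinnertonDyer.BirchSwinnertonDyer.Theorems.PrintCFram.NoAdmissiblePrimes

end
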